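import Summits.RiemannHypothesis.RiemannHypothesis.Theorems.WeilGroundStateGroundStatesConvergeToXiEvenWitness
import Summits.RiemannHypothesis.RiemannHypothesis.Theorems.OddSectorOddOneSignedWindowsRealPart
import Literature.NumberTheory.LFunctions.WeilGroundState
import Literature.NumberTheory.LFunctions.WeilMellinBounds
import Literature.NumberTheory.LFunctions.RiemannXi
import Literature.NumberTheory.LFunctions.RiemannXiProofs
import Literature.NumberTheory.LFunctions.RiemannXiHadamardProduct
import HarnessLib

/-!
# Stub `stub_realWitness_tight` of the line `Sketch`
(crux `WeilGroundState.GroundStatesConvergeToXi`, item stmt-RiemannHypothesis-1527, rev L8)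

**Real normal form of even crux witnesses (RH-free).**  Let `a_k → ∞`, `u_k` EVEN ground
states of Weil's truncated quadratic form (`IsWeilGroundState (a k) (u k)`, `u_k(-t) = u_k(t)`)
and `c_k ∈ ℂ` with `c_k · weilMellin u_k → ξ` locally uniformly on the open critical strip
`S = {0 < Re s < 1}`.  Granting the statement of the neighbouring stub `stub_rePart_groundState`
(the `L²`-normalised real part of a ground state is a ground state) as a hypothesis, there is a
witness of the same shape with REAL-VALUED even ground states `v_k` and REAL POSITIVE constants
`c'_k`, and for every exponent `b` the `b`-tightness bound
`sup_k ∫ ‖c_k u_k(t)‖ e^{b|t|} dt < ∞` transfers to `(c'_k, v_k)`.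

Construction (`stub_realWitness_tight`).
1. *Phases.* `U_k = (c_k/|c_k|) u_k` (`U_k = u_k` if `c_k = 0`) is a ground state
   (`IsWeilGroundState.const_mul`), even, with `|c_k| U_k = c_k u_k`; so `|c_k| Û_k = c_k û_k`.
2. *Conjugate witness.* `(conj f)^(s) = conj f̂(conj s)` (`realWitness_weilMellin_conj`), and if
   `F_k → ξ` locally uniformly on `S` then `conj F_k(conj ·) → conj ξ(conj ·) = ξ`
   (`riemannXi_conj_holds`; `S` is `conj`-invariant and `conj` is an isometry).
3. *Real parts.* `(Re U_k)^ = (Û_k + conj Û_k(conj ·))/2` (`realWitness_weilMellin_re`), hence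
   `|c_k| (Re U_k)^ = (F_k + conj F_k(conj ·))/2 → ξ` locally uniformly on `S`.
4. *Non-degeneracy.* At `s = 1/2 ∈ S`, `ξ(1/2) ≠ 0` (`riemannXi_one_half_ne_zero`), so for
   `k ≥ K₀`: `c_k ≠ 0` and `(Re U_k)^(1/2) ≠ 0`, whence `N_k = ∫ |Re U_k|² > 0`
   (`weilMellin_eq_zero_of_integral_norm_sq_eq_zero`, `OddSector.memLp_rePart`).
5. *The witness* is the tail `v_k = Re U_{k+K₀}/√N_{k+K₀}` (a ground state by the hypothesis),
   `c'_k = |c_{k+K₀}| √N_{k+K₀} > 0`: `c'_k v_k = |c| Re U = Re(c u)` up to the cast, so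
   `‖c'_k v_k‖ ≤ ‖c u‖` pointwise (`|Re z| ≤ |z|`) and tightness transfers with the same bound;
   `c'_k v̂_k = |c| (Re U)^ → ξ`.

Mathlib + proved tree material only; no named fact; no definitions; standard axioms.
-/

set_option linter.dupNamespace false

noncomputable section

open MeasureTheory Complex Filter Set
open scoped Real Topology ComplexConjugate

namespace Summit.RiemannHypothesis.RiemannHypothesis.Theorems.GroundStatesConvergeToXi

open Literature.NumberTheory.LFunctions

/-! ## Conjugation and real parts under the Mellin–Laplace transform -/

/-- Conjugating the Mellin integrand: `conj (f(t) e^{(conj s - 1/2)t}) = conj f(t) · e^{(s - 1/2)t}`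
for real `t`. [folklore] -/
theorem realWitness_conj_weilIntegrand (f : ℝ → ℂ) (s : ℂ) (t : ℝ) :
    conj (f t * cexp ((conj s - 1 / 2) * t)) = conj (f t) * cexp ((s - 1 / 2) * t) := by
  simp only [map_mul, ← Complex.exp_conj, map_sub, map_div₀, map_one, map_ofNat,
    Complex.conj_ofReal, Complex.conj_conj]

/-- **Transform of the conjugate**: `(conj f)^(s) = conj (f̂(conj s))` for every `f : ℝ → ℂ`
(conjugation commutes with the Bochner integral; no integrability is needed, both sides being
integrals of conjugate integrands). [folklore] -/
theorem realWitness_weilMellin_conj (f : ℝ → ℂ) (s : ℂ) :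
    weilMellin (fun t ↦ conj (f t)) s = conj (weilMellin f (conj s)) := by
  rw [weilMellin, weilMellin, ← integral_conj]
  exact integral_congr_ae (Eventually.of_forall fun t ↦ (realWitness_conj_weilIntegrand f s t).symm)

/-- The conjugates of the Mellin integrands of a ground state are integrable. [folklore] -/
theorem realWitness_integrable_conj_mul_cexp {a : ℝ} {u : ℝ → ℂ} (hu : IsWeilGroundState a u)
    (s : ℂ) : Integrable fun t : ℝ ↦ conj (u t) * cexp ((s - 1 / 2) * t) := by
  have h := (Complex.conjCLE : ℂ →L[ℝ] ℂ).integrable_comp (hu.integrable_mul_cexp (conj s - 1 / 2))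
  refine h.congr (Eventually.of_forall fun t ↦ ?_)
  simp only [ContinuousLinearEquiv.coe_coe, Complex.conjCLE_apply]
  exact realWitness_conj_weilIntegrand u s t

/-- **Transform of the real part of a ground state**: `(Re u)^(s) = (û(s) + conj û(conj s))/2`
(`Re z = (z + conj z)/2` under the integral sign, both halves being integrable). [folklore] -/
theorem realWitness_weilMellin_re {a : ℝ} {u : ℝ → ℂ} (hu : IsWeilGroundState a u) (s : ℂ) :
    weilMellin (fun t ↦ (((u t).re : ℝ) : ℂ)) s =
      (weilMellin u s + conj (weilMellin u (conj s))) / 2 := by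
  rw [← realWitness_weilMellin_conj u s]
  unfold weilMellin
  rw [← integral_add (hu.integrable_mul_cexp _) (realWitness_integrable_conj_mul_cexp hu s),
    ← integral_div]
  congr 1 with t
  dsimp only
  rw [Complex.re_eq_add_conj]
  ring

/-- `(r √N) · ((√N)⁻¹ z) = r z` for `N > 0` (real casts). [folklore] -/
theorem realWitness_sqrt_cancel {N : ℝ} (hN : 0 < N) (r : ℝ) (z : ℂ) :
    ((r * Real.sqrt N : ℝ) : ℂ) * ((((Real.sqrt N)⁻¹ : ℝ) : ℂ) * z) = (r : ℂ) * z := by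
  have h : (Real.sqrt N : ℂ) ≠ 0 := Complex.ofReal_ne_zero.2 (Real.sqrt_ne_zero'.2 hN)
  rw [Complex.ofReal_mul, Complex.ofReal_inv, mul_assoc, ← mul_assoc (Real.sqrt N : ℂ),
    mul_inv_cancel₀ h, one_mul]

/-! ## Locally uniform convergence: index shifts and the conjugate witness -/

/-- Index shifts preserve locally uniform convergence along `atTop`. [folklore] -/
theorem realWitness_tendstoLocallyUniformlyOn_shift {F : ℕ → ℂ → ℂ} {f : ℂ → ℂ} {S : Set ℂ}
    (h : TendstoLocallyUniformlyOn F f atTop S) (K : ℕ) :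
    TendstoLocallyUniformlyOn (fun k ↦ F (k + K)) f atTop S := by
  intro U hU x hx
  obtain ⟨t, ht, hev⟩ := h U hU x hx
  exact ⟨t, ht, (tendsto_add_atTop_nat K).eventually hev⟩

/-- **The conjugate witness converges too**: if `F_k → ξ` locally uniformly on the open strip,
then `conj F_k(conj ·) → ξ` there (the strip is `conj`-invariant, `conj` is an isometry, and
`ξ(conj s) = conj ξ(s)`, `riemannXi_conj_holds`). [folklore] -/
theorem realWitness_tendstoLocallyUniformlyOn_conj {F : ℕ → ℂ → ℂ}
    (h : TendstoLocallyUniformlyOn F riemannXi atTop {s : ℂ | 0 < s.re ∧ s.re < 1}) :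
    TendstoLocallyUniformlyOn (fun k s ↦ conj (F k (conj s))) riemannXi atTop
      {s : ℂ | 0 < s.re ∧ s.re < 1} := by
  have hmaps : MapsTo (conj : ℂ → ℂ) {s : ℂ | 0 < s.re ∧ s.re < 1}
      {s : ℂ | 0 < s.re ∧ s.re < 1} := fun s hs ↦ by
    simpa only [mem_setOf_eq, Complex.conj_re] using hs
  have h1 := Complex.isometry_conj.uniformContinuous.comp_tendstoLocallyUniformlyOn
    (h.comp (conj : ℂ → ℂ) hmaps Complex.continuous_conj.continuousOn)
  refine (h1.congr fun k s _ ↦ ?_).congr_right fun s _ ↦ ?_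
  · simp only [Function.comp_apply]
  · simp only [Function.comp_apply]
    rw [riemannXi_conj_holds s, Complex.conj_conj]

/-! ## The stub -/

/-- **Stub W2b — `realWitness_tight` (RH-free; takes the statement of `stub_rePart_groundState`
as its first hypothesis).**  An EVEN crux-shaped witness (`a_k → ∞`, even ground states `u_k`,
`c_k · weilMellin u_k → ξ` locally uniformly on the open strip) yields a REAL-VALUED EVEN
crux-shaped witness with REAL POSITIVE constants such that `b`-tightness transfers for every `b`.
Construction: rotate the phase, `U_k = (c_k/|c_k|) u_k` (a ground state, `|c_k| U_k = c_k u_k`);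
the conjugate witness converges, `conj (c_k û_k (conj s)) → conj ξ(conj s) = ξ(s)`, so
`|c_k| (Re U_k)^ = (F_k(s) + conj F_k(conj s))/2 → ξ(s)`; at `s = 1/2`, `ξ(1/2) ≠ 0` forces
`c_k ≠ 0` and `Re U_k ≠ 0` in `L²` for `k ≥ K₀`; the tail `v_k = Re U_k/‖Re U_k‖₂` consists of
ground states by the hypothesis, `c'_k = |c_k| ‖Re U_k‖₂ > 0`, and `c'_k v_k = Re(c_k u_k)`
pointwise, so `|Re z| ≤ |z|` transfers tightness with the same bound. [folklore] -/
theorem stub_realWitness_tight :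
    (∀ (a : ℝ) (u : ℝ → ℂ), IsWeilGroundState a u →
      0 < ∫ t, ‖(((u t).re : ℝ) : ℂ)‖ ^ 2 →
      IsWeilGroundState a (fun t =>
        (((Real.sqrt (∫ s, ‖(((u s).re : ℝ) : ℂ)‖ ^ 2))⁻¹ : ℝ) : ℂ) * (((u t).re : ℝ) : ℂ))) →
    ∀ (a : ℕ → ℝ) (u : ℕ → ℝ → ℂ) (c : ℕ → ℂ), Tendsto a atTop atTop →
      (∀ k, IsWeilGroundState (a k) (u k)) → (∀ k t, u k (-t) = u k t) →
      TendstoLocallyUniformlyOn (fun k s => c k * weilMellin (u k) s) riemannXi atTop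
        {s : ℂ | 0 < s.re ∧ s.re < 1} →
      ∃ a' : ℕ → ℝ, ∃ v : ℕ → ℝ → ℂ, ∃ c' : ℕ → ℝ, Tendsto a' atTop atTop ∧ (∀ k, 0 < c' k) ∧
        (∀ k, IsWeilGroundState (a' k) (v k)) ∧ (∀ k t, v k (-t) = v k t) ∧
        (∀ k t, (v k t).im = 0) ∧
        (∀ b : ℝ, (∃ M : ℝ, ∀ k, ∫ t, ‖c k * u k t‖ * Real.exp (b * |t|) ≤ M) →
          ∃ M : ℝ, ∀ k, ∫ t, ‖(c' k : ℂ) * v k t‖ * Real.exp (b * |t|) ≤ M) ∧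
        TendstoLocallyUniformlyOn (fun k s => (c' k : ℂ) * weilMellin (v k) s) riemannXi atTop
          {s : ℂ | 0 < s.re ∧ s.re < 1} := by
  intro hre a u c ha hu hev hlim
  classical
  -- Step 1: rotate the phases, `U_k = (c_k/|c_k|) u_k`, so that the constants become `|c_k|`.
  obtain ⟨U, hU, hUev, hUc⟩ : ∃ U : ℕ → ℝ → ℂ, (∀ k, IsWeilGroundState (a k) (U k)) ∧
      (∀ k t, U k (-t) = U k t) ∧ ∀ k t, ((‖c k‖ : ℝ) : ℂ) * U k t = c k * u k t := by
    refine ⟨fun k t ↦ (if c k = 0 then 1 else c k / ‖c k‖) * u k t,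
      fun k ↦ (hu k).const_mul ?_, fun k t ↦ by simp only [hev], fun k t ↦ ?_⟩
    · split_ifs with h
      · simp
      · rw [norm_div, Complex.norm_real, norm_norm, div_self (norm_ne_zero_iff.2 h)]
    · show ((‖c k‖ : ℝ) : ℂ) * ((if c k = 0 then 1 else c k / ‖c k‖) * u k t) = c k * u k t
      split_ifs with h
      · simp [h]
      · rw [← mul_assoc, mul_div_cancel₀ _ (Complex.ofReal_ne_zero.2 (norm_ne_zero_iff.2 h))]
  have hUM : ∀ k s, ((‖c k‖ : ℝ) : ℂ) * weilMellin (U k) s = c k * weilMellin (u k) s := by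
    intro k s
    rw [← weilMellin_const_mul, ← weilMellin_const_mul]
    congr 1
    funext t
    exact hUc k t
  -- Step 2: `|c_k| (Re U_k)^ = (F_k + conj F_k (conj ·))/2 → ξ` locally uniformly on the strip.
  have hG := realWitness_tendstoLocallyUniformlyOn_conj hlim
  have hH : TendstoLocallyUniformlyOn
      (fun k s ↦ ((‖c k‖ : ℝ) : ℂ) * weilMellin (fun t ↦ (((U k t).re : ℝ) : ℂ)) s) riemannXi
      atTop {s : ℂ | 0 < s.re ∧ s.re < 1} := by
    have h2 := (uniformContinuous_div_const' (2 : ℂ)).comp_tendstoLocallyUniformlyOn (hlim.add hG)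
    refine (h2.congr fun k s _ ↦ ?_).congr_right fun s _ ↦ ?_
    · simp only [Function.comp_apply, Pi.add_apply]
      rw [realWitness_weilMellin_re (hU k), ← hUM k s, ← hUM k (conj s), map_mul,
        Complex.conj_ofReal]
      ring
    · simp only [Function.comp_apply, Pi.add_apply]
      ring
  -- Step 3: non-degeneracy at `s = 1/2` for `k ≥ K₀`.
  have hhalf : (1 / 2 : ℂ) ∈ {s : ℂ | 0 < s.re ∧ s.re < 1} := by
    simp only [mem_setOf_eq]
    norm_num
  obtain ⟨K₀, hK₀⟩ := eventually_atTop.1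
    ((hH.tendsto_at hhalf).eventually_ne riemannXi_one_half_ne_zero)
  have hK : ∀ k, ((‖c (k + K₀)‖ : ℝ) : ℂ) *
      weilMellin (fun t ↦ (((U (k + K₀) t).re : ℝ) : ℂ)) (1 / 2) ≠ 0 := fun k ↦
    hK₀ (k + K₀) (Nat.le_add_left _ _)
  have hcpos : ∀ k, 0 < ‖c (k + K₀)‖ := fun k ↦ by
    refine norm_pos_iff.2 fun h0 ↦ hK k ?_
    rw [h0, norm_zero, Complex.ofReal_zero, zero_mul]
  have hNpos : ∀ k, 0 < ∫ t, ‖(((U (k + K₀) t).re : ℝ) : ℂ)‖ ^ 2 := fun k ↦ by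
    refine (integral_nonneg fun t ↦ by positivity).lt_of_ne fun h0 ↦ hK k ?_
    rw [weilMellin_eq_zero_of_integral_norm_sq_eq_zero
      (OddSector.memLp_rePart (hU (k + K₀)).memLp) h0.symm, mul_zero]
  -- Step 4: the real even witness, a tail of the normalised real parts.
  refine ⟨fun k ↦ a (k + K₀),
    fun k t ↦ (((Real.sqrt (∫ s, ‖(((U (k + K₀) s).re : ℝ) : ℂ)‖ ^ 2))⁻¹ : ℝ) : ℂ) *
      (((U (k + K₀) t).re : ℝ) : ℂ),
    fun k ↦ ‖c (k + K₀)‖ * Real.sqrt (∫ s, ‖(((U (k + K₀) s).re : ℝ) : ℂ)‖ ^ 2),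
    ha.comp (tendsto_add_atTop_nat K₀),
    fun k ↦ mul_pos (hcpos k) (Real.sqrt_pos.2 (hNpos k)),
    fun k ↦ hre _ _ (hU (k + K₀)) (hNpos k),
    fun k t ↦ by simp only [hUev],
    fun k t ↦ by
      simp only [Complex.mul_im, Complex.ofReal_re, Complex.ofReal_im, mul_zero, zero_mul,
        add_zero],
    ?_, ?_⟩
  · -- tightness transfers: `‖c'_k v_k(t)‖ = |c| |Re U(t)| ≤ ‖c u(t)‖` pointwise
    rintro b ⟨M, hM⟩
    refine ⟨M, fun k ↦ le_trans ?_ (hM (k + K₀))⟩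
    have hbig : Integrable fun t ↦ ‖c (k + K₀) * u (k + K₀) t‖ * Real.exp (b * |t|) := by
      have h1 := (((hu (k + K₀)).integrable_mul_continuous
        (w := fun t ↦ ((Real.exp (b * |t|) : ℝ) : ℂ)) (by fun_prop)).norm.const_mul ‖c (k + K₀)‖)
      refine h1.congr (Eventually.of_forall fun t ↦ ?_)
      simp only [norm_mul, Complex.norm_real, Real.norm_eq_abs, Real.abs_exp]
      ring
    refine integral_mono_of_nonneg (Eventually.of_forall fun t ↦ by positivity) hbig
      (Eventually.of_forall fun t ↦ ?_)
    dsimp only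
    refine mul_le_mul_of_nonneg_right ?_ (Real.exp_pos _).le
    rw [realWitness_sqrt_cancel (hNpos k), ← hUc]
    simp only [norm_mul, Complex.norm_real, Real.norm_eq_abs, abs_norm]
    exact mul_le_mul_of_nonneg_left (Complex.abs_re_le_norm _) (norm_nonneg _)
  · -- convergence: `c'_k v̂_k = |c| (Re U)^ → ξ`
    refine (realWitness_tendstoLocallyUniformlyOn_shift hH K₀).congr fun k s _ ↦ ?_
    dsimp only
    rw [weilMellin_const_mul, realWitness_sqrt_cancel (hNpos k)]

end Summit.RiemannHypothesis.RiemannHypothesis.Theorems.GroundStatesConvergeToXi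

end
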